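import Mathlib
import Literature.Analysis.Calculus.SmoothCutoff
import Literature.Analysis.FluidPDE.BackwardUniquenessCutoff
import Literature.Analysis.FluidPDE.LeiZhang2011Proofs

/-!
# Crux `SkeletonJ1R` (stmt-NavierStokesRegularity-23610) · line `streamline_kantorovich_R` · toward stub F2-d (`LiaDefectDerivBL`, v7), tools of S4′ for B1′:
# THE DERIVATIVE OF THE SWITCH PROFILE IS LIPSCHITZ, and the two-point (telescoping) bound for `a • (u × v)`

Hand `leafhand-ns-filamentskeletonrs-1` (gen 0), `--supports stmt-NavierStokesRegularity-23610 --as helper`.  MODEL rung, NEGATIVE side of the ladder: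
calculus for a HYPOTHETICAL filament-type blow-up skeleton; nothing here is a claim about Navier–Stokes regularity; the stub and the crux stay OPEN.

The Lipschitz constant `H′` of `x‴ = Z` on the window (input of `…LiaSelfDerivEstimate.symmDerivStrand_sub_lia_le`) is assembled from two-point bounds of the
factors of `Z = b φ₁•x′×W + b φ₀•(x′×(W∘x)′ + x″×W)` (`…LiaThirdDerivative`): `φ₁` carries `χ′ = (Real.smoothTransition)′`, whose Lipschitz constant is
`sup|χ″|` — `exists_deriv_smoothTransition_lipschitz` (from the landed `Literature.Analysis.FluidPDE.Carleman.exists_bound_deriv_deriv_smoothTransition`); and the algebraic telescoping `norm_smul_cross_sub_le`: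
`‖a₁•(u₁×v₁) − a₂•(u₂×v₂)‖ ≤ |a₁ − a₂|‖u₁‖‖v₁‖ + |a₂|(‖u₁ − u₂‖‖v₁‖ + ‖u₂‖‖v₁ − v₂‖)`.
-/

set_option linter.dupNamespace false -- `NavierStokesRegularity.NavierStokesRegularity` path/namespace repetition is the tree convention

noncomputable section

namespace Summit.NavierStokesRegularity.NavierStokesRegularity.Theorems.SkeletonJ1RFrame

open Set Function Filter MeasureTheory Real Topology
open Literature.Analysis.FluidPDE Literature.Analysis.Calculus
open scoped InnerProductSpace BigOperators

/-! ## §1 `χ″` is bounded, `χ′` is Lipschitz -/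

/-- **`χ′` is Lipschitz**: `|χ′ a − χ′ b| ≤ D₂|a − b|`. [folklore] -/
theorem exists_deriv_smoothTransition_lipschitz :
    ∃ D : ℝ, 0 ≤ D ∧ ∀ a b : ℝ, |deriv Real.smoothTransition a - deriv Real.smoothTransition b| ≤ D * |a - b| := by
  obtain ⟨D, hD0, hD⟩ := Literature.Analysis.FluidPDE.Carleman.exists_bound_deriv_deriv_smoothTransition
  have hd : Differentiable ℝ (deriv Real.smoothTransition) := (Real.smoothTransition.contDiff (n := 2)).differentiable_deriv_two
  refine ⟨D, hD0, fun a b => ?_⟩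
  have h := Convex.norm_image_sub_le_of_norm_deriv_le (f := deriv Real.smoothTransition) (C := D) (s := Set.univ) (fun x _ => hd x)
    (fun x _ => by rw [Real.norm_eq_abs]; exact hD x) convex_univ (Set.mem_univ b) (Set.mem_univ a)
  rwa [Real.norm_eq_abs, Real.norm_eq_abs] at h

/-! ## §2 Telescoping two-point bounds -/

/-- `‖a₁•(u₁×v₁) − a₂•(u₂×v₂)‖ ≤ |a₁ − a₂|‖u₁‖‖v₁‖ + |a₂|(‖u₁ − u₂‖‖v₁‖ + ‖u₂‖‖v₁ − v₂‖)`. [folklore] -/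
theorem norm_smul_cross_sub_le (a₁ a₂ : ℝ) (u₁ u₂ v₁ v₂ : EuclideanSpace ℝ (Fin 3)) :
    ‖a₁ • cross u₁ v₁ - a₂ • cross u₂ v₂‖ ≤ |a₁ - a₂| * (‖u₁‖ * ‖v₁‖) + |a₂| * (‖u₁ - u₂‖ * ‖v₁‖ + ‖u₂‖ * ‖v₁ - v₂‖) := by
  have hsplit : a₁ • cross u₁ v₁ - a₂ • cross u₂ v₂ = (a₁ - a₂) • cross u₁ v₁ + a₂ • (cross u₁ v₁ - cross u₂ v₂) := by
    rw [sub_smul, smul_sub]; abel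
  have hcross : cross u₁ v₁ - cross u₂ v₂ = cross (u₁ - u₂) v₁ + cross u₂ (v₁ - v₂) := by
    rw [← crossCLM_apply, ← crossCLM_apply, ← crossCLM_apply, ← crossCLM_apply, map_sub, map_sub, sub_apply]
    abel
  rw [hsplit]
  refine (norm_add_le _ _).trans (add_le_add ?_ ?_)
  · rw [norm_smul, Real.norm_eq_abs]
    exact mul_le_mul_of_nonneg_left (norm_cross_le_norm_mul_norm _ _) (abs_nonneg _)
  · rw [norm_smul, Real.norm_eq_abs, hcross]
    refine mul_le_mul_of_nonneg_left ((norm_add_le _ _).trans (add_le_add ?_ ?_)) (abs_nonneg _)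
    · exact norm_cross_le_norm_mul_norm _ _
    · exact norm_cross_le_norm_mul_norm _ _

/-- `‖a₁•w₁ − a₂•w₂‖ ≤ |a₁ − a₂|‖w₁‖ + |a₂|‖w₁ − w₂‖` (scalar × vector telescoping). [folklore] -/
theorem norm_smul_sub_smul_le (a₁ a₂ : ℝ) (w₁ w₂ : EuclideanSpace ℝ (Fin 3)) :
    ‖a₁ • w₁ - a₂ • w₂‖ ≤ |a₁ - a₂| * ‖w₁‖ + |a₂| * ‖w₁ - w₂‖ := by
  have hsplit : a₁ • w₁ - a₂ • w₂ = (a₁ - a₂) • w₁ + a₂ • (w₁ - w₂) := by rw [sub_smul, smul_sub]; abel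
  rw [hsplit]
  refine (norm_add_le _ _).trans ?_
  rw [norm_smul, norm_smul, Real.norm_eq_abs, Real.norm_eq_abs]

end Summit.NavierStokesRegularity.NavierStokesRegularity.Theorems.SkeletonJ1RFrame

end
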